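import Summits.BirchSwinnertonDyer.BirchSwinnertonDyer.Theorems.PrintCFramBottomClassIndexLawFiveLeBorelUniserialLayers
import Summits.BirchSwinnertonDyer.BirchSwinnertonDyer.Theorems.PrintCFramBottomClassIndexLawFiveLeBorelNonScalarLeaf
import HarnessLib

/-!
# Route `PrintCFram`, crux C2 `BottomClassIndexLawFiveLe` (stmt-BirchSwinnertonDyer-20372), line
# `eisenstein-resource-bdp-line` (S2 `stub_kolyvaginUpper_borelCM_pairSum`): **`W[p^M]` IS UNISERIAL UNDER `Γ_K`** —
# the `Γ_K`-stable subgroups of `W[p^M]` are the layers `μ^j·W[p^M]` (`μ = √−p`), totally ordered and determined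
# by their order, for every CM-ramified class, every quadratic `K`, every `M ≥ 1`
# (cell `bsd-print-cfram`, seat `bsd-line-cfram-p1-w4` g3; helper `--supports` 20372; 0 facts, 0 defs)

HONEST FRAMING. Nothing about BSD is proved here, and nothing of S2 itself. This is the level-`p^M` form of the
layer statement «the `Γ`-submodules of `𝓞/𝔭^k` are the `𝔭^j`» on which the crux's visibility analysis
(`Lines/borel-heegner-squeeze-H1check.md` §3) and a Borel version of `KolyvaginPairing.eq_piTors_of_stable_of_indep` /
McCallum (2) at level `p^M` rest; the level-`1` trichotomy is `…BorelStableLine.lean` (p642364). It combines w2 g5's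
`𝓞`-structure (`BorelHomothety.exists_generator_pair`: `W[p^M] = ℤv + ℤμv`; `smul_eq_smul_add_smul_of_comm`: an
element of `Γ_ℚ` fixing `√−p` acts on `W[p^M]` as `a + bμ`) with this seat's non-scalar Frobenius (p641246) and the
generic layer algebra of `…BorelUniserialLayers.lean`.

MECHANISM (kit 0; no CM theory; no counting). **`apply_mem_of_stable_of_cmRamified`**: a subgroup of `W[p^M]`
stable under `res Γ_K` is `μ`-STABLE — the non-scalar `σ` fixing `√−p` acts on `W[p^M]` as `a + bμ` with `p ∤ b`
(else `σ` is the scalar `a` on `W[p]`) and `p ∤ a` (else `σ² = b²μ² = 0` on `W[p]`), so `σ² ∈ res Γ_K` (index `2`)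
acts as `(a² + mb²) + 2ab·μ` with `2ab` a unit modulo `p^M`, and `μP = c·(σ²P − (a² + mb²)P) ∈ H`. Then the
generic classification applies: `exists_eq_map_pow_of_stable_of_cmRamified` (every stable `H` is a layer
`(W[p^M]).map (μ ^ j)`, for any given `μ = √−p`), and the `μ`-FREE consequences
**`le_or_le_of_stable_of_cmRamified`** (any two `res Γ_K`-stable subgroups of `W[p^M]` are comparable),
`eq_of_stable_of_card_eq_pow_of_cmRamified` (equal order ⟹ equal), and in the machine's currency
**`le_or_le_of_stable_baseChange_of_cmRamified`** / `eq_of_stable_of_card_eq_baseChange_of_cmRamified` on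
`geomTorsion (W.baseChange K) (p^M) ⊂ E(K̄)` with `absoluteGaloisGroup K` (transport along `RatClosure.torsionEquiv`).

THEOREMS ONLY; no definition, no named fact, no `sorry`; imports no `Theses` module. BSD is not proved by any of
this; no summit statement is proved by this seat.
References: [Rubin1999] Prop. 5.4, Cor. 5.5 (E[𝔭ⁿ] ≅ 𝒪/𝔭ⁿ cyclic, Galois acts 𝒪-semilinearly); [GrossLMS1991] §9
(where the level-`p` input is consumed); [McCallum1991] §3 (level `p^M`).
-/

set_option autoImplicit false
-- `…BirchSwinnertonDyer.BirchSwinnertonDyer.Theorems…` is the problem's mandated namespace (D-0017).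
set_option linter.dupNamespace false

noncomputable section

namespace Summit.BirchSwinnertonDyer.BirchSwinnertonDyer.Theorems.PrintCFram.BorelNonScalar

section Leaf

open scoped Classical

open WeierstrassCurve Field Literature.NumberTheory.EllipticCurves Literature.NumberTheory.GaloisRepresentations
  Literature.NumberTheory.EllipticCurves.Rank1Residual Summit.BirchSwinnertonDyer.Rank1Residual.X12.O11
  Summit.BirchSwinnertonDyer.BirchSwinnertonDyer.Theorems.PrintCFram.BorelHomothety

variable (W : WeierstrassCurve ℚ) [W.IsElliptic] (p : ℕ) [hp : Fact p.Prime]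
  (K : Type) [Field K] [NumberField K]

/-- **`Γ_K`-stable ⟹ `μ`-stable on `W[p^M]`.** For `W/ℚ` elliptic with CM, `p ≥ 5` ramified in the CM field,
`μ = √−p` (any additive `μ` with `μ ∘ μ = [m]`, `|m| = p`, commuting with the `g ∈ Γ_ℚ` fixing `s`, `s² = −p`), a
quadratic number field `K` and `M ≥ 1`: a subgroup `H ≤ W[p^M]` stable under `res Γ_K` is stable under `μ`. The
non-scalar `σ` fixing `√−p` (`exists_frobenius_nonScalar_of_cmRamified`) acts on `W[p^M]` as `a + bμ`
(`smul_eq_smul_add_smul_of_comm`) with `p ∤ a`, `p ∤ b`; `σ² ∈ res Γ_K` acts as `(a² + mb²) + 2ab·μ`, and `2ab` is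
a unit modulo `p^M`. [cite: Rubin1999, Cor. 5.5 (the Galois action is 𝒪-semilinear, E[𝔭ⁿ] cyclic)] -/
theorem apply_mem_of_stable_of_cmRamified (hCM : W.HasCM) (h5 : 5 ≤ p) (hram : CMRamified W p)
    (hK2 : Module.finrank ℚ K = 2) {s : AlgebraicClosure ℚ} (hs : s ^ 2 = ((-(p : ℤ) : ℤ) : AlgebraicClosure ℚ))
    {μ : AddMonoid.End W.geomPoints} {m : ℤ} (hμμ : ∀ P, μ (μ P) = m • P) (hm : m.natAbs = p)
    (hμ₁ : ∀ g : absoluteGaloisGroup ℚ, g • s = s → ∀ P, μ (g • P) = g • μ P) {M : ℕ} (hM : 1 ≤ M)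
    {H : AddSubgroup W.geomPoints} (hHT : H ≤ W.geomTorsion ((p ^ M : ℕ) : ℤ))
    (hH : ∀ (g : absoluteGaloisGroup K), ∀ P ∈ H, absGaloisRestrict ℚ K g • P ∈ H) :
    ∀ P ∈ H, μ P ∈ H := by
  have hpr : p.Prime := hp.out
  have hne := exists_mem_geomTorsion_apply_ne_zero W p hμμ hm
  obtain ⟨σ, hσs, hσ⟩ := exists_frobenius_nonScalar_of_cmRamified p W hCM h5 hram hs
  obtain ⟨a, b, hab⟩ := smul_eq_smul_add_smul_of_comm W p hμμ hm hne hM (hμ₁ σ hσs)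
  obtain ⟨g₁, hg₁⟩ : σ ^ 2 ∈ (absGaloisRestrict ℚ K).range := by
    have hHi : (absGaloisRestrict ℚ K).range.index = 2 :=
      (index_range_absGaloisRestrict_eq_finrank ℚ K).trans hK2
    haveI : (absGaloisRestrict ℚ K).range.Normal := Subgroup.normal_of_index_eq_two hHi
    haveI : (absGaloisRestrict ℚ K).range.FiniteIndex := ⟨by rw [hHi]; decide⟩
    have := Subgroup.pow_index_mem (absGaloisRestrict ℚ K).range σ
    rwa [hHi] at this
  change absGaloisRestrict ℚ K g₁ = σ ^ 2 at hg₁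
  -- `W[p] ≤ W[p^M]`
  have hpM : ∀ Q : W.geomPoints, Q ∈ W.geomTorsion (p : ℤ) → Q ∈ W.geomTorsion ((p ^ M : ℕ) : ℤ) := by
    intro Q hQ
    rw [AddSubgroup.torsionBy.nsmul_iff] at hQ ⊢
    obtain ⟨k, hk⟩ : p ∣ p ^ M := dvd_pow_self p (by omega)
    rw [hk, mul_nsmul, hQ, smul_zero]
  -- `p ∤ b`: otherwise `σ` is the scalar `a` on `W[p]`
  have hpb : ¬ (p : ℤ) ∣ b := by
    rintro ⟨b', rfl⟩
    obtain ⟨Q, hQ⟩ := hσ a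
    apply hQ
    apply Subtype.ext
    rw [AddSubgroup.torsionBy.coe_smul, AddSubgroupClass.coe_zsmul, hab _ (hpM _ Q.2), mul_comm, ← smul_smul,
      natCast_zsmul]
    have hμQ : μ (Q : W.geomPoints) ∈ W.geomTorsion (p : ℤ) :=
      apply_mem_torsionBy (μ : W.geomPoints →+ W.geomPoints) Q.2
    rw [AddSubgroup.torsionBy.nsmul_iff.mp hμQ, smul_zero, add_zero]
  -- `p ∤ a`: otherwise `σ² = 0` on `W[p]`
  have hpa : ¬ (p : ℤ) ∣ a := by
    rintro ⟨a', rfl⟩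
    obtain ⟨P₀, hP₀, hμP₀⟩ := hne
    have hP₀0 : P₀ ≠ 0 := fun h => hμP₀ (by rw [h, map_zero])
    have haQ : ∀ Q ∈ W.geomTorsion (p : ℤ), ((p : ℤ) * a') • Q = 0 := fun Q hQ => by
      rw [mul_comm, ← smul_smul, natCast_zsmul, AddSubgroup.torsionBy.nsmul_iff.mp hQ, smul_zero]
    have hσQ : ∀ Q ∈ W.geomTorsion (p : ℤ), σ • Q = b • μ Q := fun Q hQ => by
      rw [hab _ (hpM _ hQ), haQ Q hQ, zero_add]
    have hμP₀p : μ P₀ ∈ W.geomTorsion (p : ℤ) := apply_mem_torsionBy (μ : W.geomPoints →+ W.geomPoints) hP₀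
    have hσP₀p : σ • P₀ ∈ W.geomTorsion (p : ℤ) := Literature.NumberTheory.EllipticCurves.smul_mem_torsionBy σ hP₀
    have h0 : σ • σ • P₀ = 0 := by
      have hmP : m • P₀ = 0 := by
        have hmP' : m.natAbs • P₀ = 0 := by rw [hm]; exact AddSubgroup.torsionBy.nsmul_iff.mp hP₀
        exact natAbs_nsmul_eq_zero.mp hmP'
      rw [hσQ _ hσP₀p, hμ₁ σ hσs, hσQ _ hμP₀p, hμμ, hmP, smul_zero, smul_zero]
    rw [smul_eq_zero_iff_eq, smul_eq_zero_iff_eq] at h0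
    exact hP₀0 h0
  -- `2ab` is a unit modulo `p^M`
  have hp2 : ¬ (p : ℤ) ∣ 2 := by
    intro h
    have := Int.le_of_dvd (by norm_num) h
    have : (p : ℤ) ≥ 5 := by exact_mod_cast h5
    omega
  have hP : Prime (p : ℤ) := Nat.prime_iff_prime_int.mp hpr
  have hcop : IsCoprime ((p : ℤ) ^ M) (2 * a * b) := by
    refine IsCoprime.pow_left ((hP.coprime_iff_not_dvd).mpr ?_)
    intro h
    rcases hP.dvd_or_dvd h with h | h
    · rcases hP.dvd_or_dvd h with h | h
      · exact hp2 h
      · exact hpa h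
    · exact hpb h
  obtain ⟨x, c, hxc⟩ := hcop
  intro P hPH
  have hPT := hHT hPH
  have hμPT : μ P ∈ W.geomTorsion ((p ^ M : ℕ) : ℤ) := apply_mem_torsionBy (μ : W.geomPoints →+ W.geomPoints) hPT
  have hσPT : σ • P ∈ W.geomTorsion ((p ^ M : ℕ) : ℤ) := Literature.NumberTheory.EllipticCurves.smul_mem_torsionBy σ hPT
  -- `σ² P = (a² + b²m) P + 2ab μP`
  have hσσ : σ • σ • P = (a * a + b * b * m) • P + (2 * a * b) • μ P := by
    rw [hab _ hσPT, hμ₁ σ hσs, hab _ hμPT, hμμ, hab _ hPT]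
    simp only [smul_add, smul_smul]
    module
  have hmem : σ • σ • P ∈ H := by
    have := hH g₁ P hPH
    rwa [hg₁, pow_two, mul_smul] at this
  have h2ab : (2 * a * b) • μ P ∈ H := by
    have : (2 * a * b) • μ P = σ • σ • P - (a * a + b * b * m) • P := by rw [hσσ]; abel
    rw [this]
    exact sub_mem hmem (AddSubgroup.zsmul_mem _ hPH _)
  have hpMμ : ((p : ℤ) ^ M) • μ P = 0 := by
    have := AddSubgroup.torsionBy.nsmul_iff.mp hμPT
    rw [← natCast_zsmul] at this
    exact_mod_cast this
  have : μ P = c • ((2 * a * b) • μ P) := by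
    calc μ P = (x * (p : ℤ) ^ M + c * (2 * a * b)) • μ P := by rw [hxc, one_smul]
      _ = x • (((p : ℤ) ^ M) • μ P) + c • ((2 * a * b) • μ P) := by rw [add_smul, mul_smul, mul_smul]
      _ = c • ((2 * a * b) • μ P) := by rw [hpMμ, smul_zero, zero_add]
  rw [this]
  exact AddSubgroup.zsmul_mem _ h2ab c


/-- **The `Γ_K`-stable subgroups of `W[p^M]` are the layers `μ^j·W[p^M]`** (`j ≤ 2M`), for any `μ = √−p` as above.
[cite: Rubin1999, Prop. 5.4 and Cor. 5.5 (E[𝔭ⁿ] ≅ 𝒪/𝔭ⁿ; submodules are the 𝔭-powers)] -/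
theorem exists_eq_map_pow_of_stable_of_cmRamified (hCM : W.HasCM) (h5 : 5 ≤ p) (hram : CMRamified W p)
    (hK2 : Module.finrank ℚ K = 2) {s : AlgebraicClosure ℚ} (hs : s ^ 2 = ((-(p : ℤ) : ℤ) : AlgebraicClosure ℚ))
    {μ : AddMonoid.End W.geomPoints} {m : ℤ} (hμμ : ∀ P, μ (μ P) = m • P) (hm : m.natAbs = p)
    (hμ₁ : ∀ g : absoluteGaloisGroup ℚ, g • s = s → ∀ P, μ (g • P) = g • μ P) {M : ℕ} (hM : 1 ≤ M)
    {H : AddSubgroup W.geomPoints} (hHT : H ≤ W.geomTorsion ((p ^ M : ℕ) : ℤ))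
    (hH : ∀ (g : absoluteGaloisGroup K), ∀ P ∈ H, absGaloisRestrict ℚ K g • P ∈ H) :
    ∃ j ≤ 2 * M, H = (W.geomTorsion ((p ^ M : ℕ) : ℤ)).map ((μ ^ j : AddMonoid.End W.geomPoints) :
      W.geomPoints →+ W.geomPoints) := by
  have hne := exists_mem_geomTorsion_apply_ne_zero W p hμμ hm
  obtain ⟨v, hv, hgen⟩ := exists_generator_pair (μ : W.geomPoints →+ W.geomPoints) hμμ hm hp.out
    (W.natCard_geomTorsion_prime_eq_sq hp.out) hne hM (natCard_geomTorsion_pow W p M)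
  exact exists_eq_map_pow_of_stable μ hμμ hm hp.out hv hgen hHT
    (apply_mem_of_stable_of_cmRamified W p K hCM h5 hram hK2 hs hμμ hm hμ₁ hM hHT hH)

/-- **Uniseriality.** For `W/ℚ` elliptic with CM, `p ≥ 5` ramified in the CM field, a quadratic number field `K` and
`M ≥ 1`: any two `res Γ_K`-stable subgroups of `W[p^M] ⊂ W(ℚ̄)` are COMPARABLE.
[cite: Rubin1999, Prop. 5.4 and Cor. 5.5 (E[𝔭ⁿ] ≅ 𝒪/𝔭ⁿ; submodules are the 𝔭-powers)] -/
theorem le_or_le_of_stable_of_cmRamified (hCM : W.HasCM) (h5 : 5 ≤ p) (hram : CMRamified W p)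
    (hK2 : Module.finrank ℚ K = 2) {M : ℕ} (hM : 1 ≤ M) {H₁ H₂ : AddSubgroup W.geomPoints}
    (h₁T : H₁ ≤ W.geomTorsion ((p ^ M : ℕ) : ℤ))
    (h₁ : ∀ (g : absoluteGaloisGroup K), ∀ P ∈ H₁, absGaloisRestrict ℚ K g • P ∈ H₁)
    (h₂T : H₂ ≤ W.geomTorsion ((p ^ M : ℕ) : ℤ))
    (h₂ : ∀ (g : absoluteGaloisGroup K), ∀ P ∈ H₂, absGaloisRestrict ℚ K g • P ∈ H₂) :
    H₁ ≤ H₂ ∨ H₂ ≤ H₁ := by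
  obtain ⟨s, μ, m, hs, hm, hμμ, hμ₁, -⟩ := exists_sqrt_end_of_cmRamified W p hCM h5 hram
  have hne := exists_mem_geomTorsion_apply_ne_zero W p hμμ hm
  obtain ⟨v, hv, hgen⟩ := exists_generator_pair (μ : W.geomPoints →+ W.geomPoints) hμμ hm hp.out
    (W.natCard_geomTorsion_prime_eq_sq hp.out) hne hM (natCard_geomTorsion_pow W p M)
  exact le_or_le_of_stable μ hμμ hm hp.out hv hgen h₁T
    (apply_mem_of_stable_of_cmRamified W p K hCM h5 hram hK2 hs hμμ hm hμ₁ hM h₁T h₁) h₂T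
    (apply_mem_of_stable_of_cmRamified W p K hCM h5 hram hK2 hs hμμ hm hμ₁ hM h₂T h₂)

/-- **Rigidity.** Under the same hypotheses, two `res Γ_K`-stable subgroups of `W[p^M]` of the same order are EQUAL.
[cite: Rubin1999, Prop. 5.4 and Cor. 5.5 (E[𝔭ⁿ] ≅ 𝒪/𝔭ⁿ; submodules are the 𝔭-powers)] -/
theorem eq_of_stable_of_card_eq_pow_of_cmRamified (hCM : W.HasCM) (h5 : 5 ≤ p) (hram : CMRamified W p)
    (hK2 : Module.finrank ℚ K = 2) {M : ℕ} (hM : 1 ≤ M) {H₁ H₂ : AddSubgroup W.geomPoints}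
    (h₁T : H₁ ≤ W.geomTorsion ((p ^ M : ℕ) : ℤ))
    (h₁ : ∀ (g : absoluteGaloisGroup K), ∀ P ∈ H₁, absGaloisRestrict ℚ K g • P ∈ H₁)
    (h₂T : H₂ ≤ W.geomTorsion ((p ^ M : ℕ) : ℤ))
    (h₂ : ∀ (g : absoluteGaloisGroup K), ∀ P ∈ H₂, absGaloisRestrict ℚ K g • P ∈ H₂)
    (hcard : Nat.card H₁ = Nat.card H₂) : H₁ = H₂ := by
  haveI : Finite (W.geomTorsion ((p ^ M : ℕ) : ℤ)) :=
    finite_torsionPoints_holds W (AlgebraicClosure ℚ) (n := p ^ M) (by exact_mod_cast pow_ne_zero M hp.out.ne_zero)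
  haveI : Finite H₁ := Finite.of_injective _ (AddSubgroup.inclusion_injective h₁T)
  haveI : Finite H₂ := Finite.of_injective _ (AddSubgroup.inclusion_injective h₂T)
  rcases le_or_le_of_stable_of_cmRamified W p K hCM h5 hram hK2 hM h₁T h₁ h₂T h₂ with h | h
  · exact AddSubgroup.eq_of_le_of_card_ge h (by rw [hcard])
  · exact (AddSubgroup.eq_of_le_of_card_ge h (by rw [hcard])).symm

/-- **Uniseriality in the machine's currency.** For `W/ℚ` elliptic with CM, `p ≥ 5` ramified in the CM field, a
quadratic number field `K` and `M ≥ 1`: any two subgroups of `E[p^M] = geomTorsion (W.baseChange K) (p^M) ⊂ E(K̄)`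
stable under `absoluteGaloisGroup K` are COMPARABLE — the level-`p^M` replacement of «`E[p]` simple» for the Borel
prime (transport along `RatClosure.torsionEquiv`).
[cite: Rubin1999, Prop. 5.4 and Cor. 5.5 (E[𝔭ⁿ] ≅ 𝒪/𝔭ⁿ; submodules are the 𝔭-powers)] -/
theorem le_or_le_of_stable_baseChange_of_cmRamified (hCM : W.HasCM) (h5 : 5 ≤ p) (hram : CMRamified W p)
    (hK2 : Module.finrank ℚ K = 2) {M : ℕ} (hM : 1 ≤ M)
    (H₁ H₂ : AddSubgroup (geomTorsion (W.baseChange K) ((p ^ M : ℕ) : ℤ)))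
    (h₁ : ∀ (g : absoluteGaloisGroup K) (t : geomTorsion (W.baseChange K) ((p ^ M : ℕ) : ℤ)), t ∈ H₁ → g • t ∈ H₁)
    (h₂ : ∀ (g : absoluteGaloisGroup K) (t : geomTorsion (W.baseChange K) ((p ^ M : ℕ) : ℤ)), t ∈ H₂ → g • t ∈ H₂) :
    H₁ ≤ H₂ ∨ H₂ ≤ H₁ := by
  set θ := RatClosure.torsionEquiv (K := K) W ((p ^ M : ℕ) : ℤ) with hθ
  -- pull back to subgroups of `W(ℚ̄)` inside `W[p^M]`
  have hle : ∀ (H : AddSubgroup (geomTorsion (W.baseChange K) ((p ^ M : ℕ) : ℤ))),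
      (H.comap θ.toAddMonoidHom).map (W.geomTorsion ((p ^ M : ℕ) : ℤ)).subtype ≤
        W.geomTorsion ((p ^ M : ℕ) : ℤ) := fun H => by
    rintro x ⟨Q, -, rfl⟩
    exact Q.2
  have hstab : ∀ (H : AddSubgroup (geomTorsion (W.baseChange K) ((p ^ M : ℕ) : ℤ))),
      (∀ (g : absoluteGaloisGroup K) t, t ∈ H → g • t ∈ H) →
      ∀ (g : absoluteGaloisGroup K), ∀ P ∈ (H.comap θ.toAddMonoidHom).map (W.geomTorsion ((p ^ M : ℕ) : ℤ)).subtype,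
        absGaloisRestrict ℚ K g • P ∈ (H.comap θ.toAddMonoidHom).map (W.geomTorsion ((p ^ M : ℕ) : ℤ)).subtype := by
    intro H hH g P hP
    obtain ⟨Q, hQ, rfl⟩ := hP
    have hQ' : θ Q ∈ H := hQ
    refine ⟨absGaloisRestrict ℚ K g • Q, ?_, rfl⟩
    show θ (absGaloisRestrict ℚ K g • Q) ∈ H
    rw [hθ, RatClosure.torsionEquiv_smul]
    exact hH g _ hQ'
  have hback : ∀ (H : AddSubgroup (geomTorsion (W.baseChange K) ((p ^ M : ℕ) : ℤ))),
      H = ((((H.comap θ.toAddMonoidHom).map (W.geomTorsion ((p ^ M : ℕ) : ℤ)).subtype).comap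
        (W.geomTorsion ((p ^ M : ℕ) : ℤ)).subtype).map θ.toAddMonoidHom) := fun H => by
    rw [AddSubgroup.comap_map_eq_self_of_injective (W.geomTorsion ((p ^ M : ℕ) : ℤ)).subtype_injective,
      AddSubgroup.map_comap_eq_self_of_surjective θ.surjective]
  rcases le_or_le_of_stable_of_cmRamified W p K hCM h5 hram hK2 hM (hle H₁) (hstab H₁ h₁) (hle H₂) (hstab H₂ h₂)
    with h | h
  · left
    rw [hback H₁, hback H₂]
    exact AddSubgroup.map_mono (AddSubgroup.comap_mono h)
  · right
    rw [hback H₁, hback H₂]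
    exact AddSubgroup.map_mono (AddSubgroup.comap_mono h)

/-- Rigidity in the machine's currency: two `Γ_K`-stable subgroups of `geomTorsion (W.baseChange K) (p^M)` of the
same order coincide. [cite: Rubin1999, Prop. 5.4 and Cor. 5.5 (E[𝔭ⁿ] ≅ 𝒪/𝔭ⁿ; submodules are the 𝔭-powers)] -/
theorem eq_of_stable_of_card_eq_baseChange_of_cmRamified (hCM : W.HasCM) (h5 : 5 ≤ p) (hram : CMRamified W p)
    (hK2 : Module.finrank ℚ K = 2) {M : ℕ} (hM : 1 ≤ M)
    (H₁ H₂ : AddSubgroup (geomTorsion (W.baseChange K) ((p ^ M : ℕ) : ℤ)))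
    (h₁ : ∀ (g : absoluteGaloisGroup K) (t : geomTorsion (W.baseChange K) ((p ^ M : ℕ) : ℤ)), t ∈ H₁ → g • t ∈ H₁)
    (h₂ : ∀ (g : absoluteGaloisGroup K) (t : geomTorsion (W.baseChange K) ((p ^ M : ℕ) : ℤ)), t ∈ H₂ → g • t ∈ H₂)
    (hcard : Nat.card H₁ = Nat.card H₂) : H₁ = H₂ := by
  haveI : Finite (geomTorsion (W.baseChange K) ((p ^ M : ℕ) : ℤ)) :=
    finite_torsionPoints_holds (W.baseChange K) (AlgebraicClosure K) (n := p ^ M)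
      (by exact_mod_cast pow_ne_zero M hp.out.ne_zero)
  rcases le_or_le_of_stable_baseChange_of_cmRamified W p K hCM h5 hram hK2 hM H₁ H₂ h₁ h₂ with h | h
  · exact AddSubgroup.eq_of_le_of_card_ge h (by rw [hcard])
  · exact (AddSubgroup.eq_of_le_of_card_ge h (by rw [hcard])).symm

end Leaf

end Summit.BirchSwinnertonDyer.BirchSwinnertonDyer.Theorems.PrintCFram.BorelNonScalar
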